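import Summits.QuantumFields.BalabanUV.Gaps.D1CoDressedLongitudinalForm

/-!
# `BalabanUV.Gaps.D1SymbolSmallMomentumGerm` — cell pub-balaban-gaps, row (D1), seat g1-p1: THE SMALL-MOMENTUM CURVATURE OF ONE DIAGONAL SYMBOL ENTRY IS THE (1.22) COEFFICIENT —
# under (5.9) + (5.8) + summable third moments, `(Σ_z P_{ββ}(z) cos(p z_α)) ∕ p² → β_{αβ}` (`p → 0`, `α ≠ β`); hence the SIGN of `β_{αβ}` needs only the eventual sign of that ONE entry
# near zero momentum (strictly weaker than the PSD binder `ConvPSD`), and conversely `β_{αβ} < 0` makes it negative for all small `p` (Lemma 5.2's contrapositive, LOCATED at `p → 0`);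
# hypothesis-free at an2's chart-(II) literal, under `hW_j` at the pinned ∕ (III′) literals

HONEST FRAMING (cell rule, page 1 of everything): [folklore] — the β sub-cell's own Tannery-at-zero argument (`PolarizationSign.cosWeight`, `sq_mul_cosWeight`, `abs_cosWeight_le`,
`continuous_cosWeight`, dominated convergence along `𝓝[≠] 0`), its `tsum_eq_zero_of_ward` and `bochner_diag_cos`, composed BY NAME with row 86's hR-free (1.22)
(`secondMoment_eq_neg_half_of_ward_indexSymmetric`), an2's `symmetries_JsRowD1Pin`, GEN 14's index-symmetry dictionary and moment summability.  (5.16) p. 293 [Balaban1987RG1]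
(*"Π_{μν}(p) = β(δ_{μν}Δ(p) − ∂̄_μ(p)∂_ν(p)) + …"*) is PRINTED for Bałaban's Π and is NOT used: the diagonal-entry ∕ axis-direction germ proved here for ANY kernel with the typed predicates is
its shadow, with the channel's OWN coefficient `β_{αβ}` (no rotation symmetry (1.21), no single `β`).  NOTHING of Bałaban's is asserted; no symbol is computed or certified; the Ward binder `hW_j`
at the pinned ∕ (III′) literals REMAINS a hypothesis; NO coefficient of Bałaban's computed or signed; (D1) NOT discharged; 0∕4 row-D1 binders at the pinned ∕ (III′) literals; NOT `BetaPertH`,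
NOT continuum, NOT Clay.
HONEST DEPENDENCY (b2b cell, verbatim): «continuum YM on T⁴ ⇐ BetaPertH ∧ nine spine estimates (0/9 proved); BetaPertH ⇐ (D1) ∧ (D4) ∧ CAP+tail; G-an2-4 gates asym, D1 and NE2/3/4.»

WHY (census row 95 of `HOME/g1/RESIDUE.md`).  Row 94 (`D1SymbolPSDCertificate`) made the PSD binder equivalent to pointwise positivity of the symbol form and LOCATED the obstruction to
a by-value certificate at `k → 0`, "where the transverse curvature is the (1.22) coefficient".  This file makes that sentence a kernel theorem, entry by entry: for the diagonal entry
`P̂_{ββ}` along the axis `e_α` (a transverse direction: `e_β ⊥ ∂(s·e_α)` for `β ≠ α`), `Re P̂_{ββ}(s·e_α) = Σ_z P_{ββ}(z) cos(2πs z_α)` (§3) and `Σ_z P_{ββ}(z) cos(p z_α) = β_{αβ}·p² + o(p²)`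
(§2).  Consequences: (i) SUFFICIENCY SHARPENED — `0 ≤ β_{αβ}` already follows from `0 ≤ Σ_z P_{ββ}(z) cos(p z_α)` for all SMALL `p ≠ 0` (one entry, one axis, a neighbourhood of zero
momentum), a hypothesis strictly weaker than `ConvPSD P` (which gives it for all `p`, `bochner_diag_cos`); (ii) NECESSITY LOCATED — `β_{αβ} < 0` forces that entry negative for all small `p`,
so no by-value PSD certificate can bypass the `p → 0` germ, whose sign IS the sign of `β`; (iii) BY VALUE (zero weight, GEN 18's RESULT-6): the observed small-`k` transverse slope
`s_T ≈ β⁰₀(0,1)` of the level-0 record kernel is this theorem's statement read numerically (up to the `2π` normalisation of `k`).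
WHAT IT IS NOT: no certificate; `hW_j` (pinned ∕ (III′)), the VALUE side of (D1), (1.21), `D1Tel` ∕ `D1Rep` untouched; the words of the row do not move.

CONTENT (all [folklore]; no `def`, no `def … : Prop`, 0 sorry): §1 **`tendsto_tsum_cos_div_sq`** (generic `Q` with `Σ Q = 0` and a second moment: `(Σ_z Q(z)cos(p z_α))∕p² → −½ Σ_z Q(z) z_α²`);
§2 **`tendsto_diag_cos_div_sq_secondMoment`** (`→ β_{αβ}` under (5.9) + (5.8) + `MomentSummable P 3`), **`secondMoment_nonneg_of_eventually_diag_cos_nonneg`**,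
**`eventually_diag_cos_neg_of_secondMoment_neg`**, `eventually_diag_cos_pos_of_secondMoment_pos`, `not_convPSD_of_secondMoment_neg`; §3 `re_symbolEntry_eq_tsum_cos`
(`Re Σ_z P_{μν}(z)e^{−2πi k·z} = Σ_z P_{μν}(z) cos(2π k·z)`, row 94's real-coordinate symbol), `re_symbolEntry_axis`; §4 literals (`d = 4`): `tsum_diag_cos_flipK`,
**`tendsto_diag_cos_div_sq_secondMoment_JsRowD1Pin`** + `secondMoment_TbalOf_JsRowD1Pin_nonneg_of_eventually_diag_cos_nonneg` (hypothesis-free),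
`tendsto_diag_cos_div_sq_secondMoment_JsBalAn1_of_hW` + `secondMoment_TbalOf_JsBalAn1_nonneg_of_hW_eventually_diag_cos_nonneg`,
`tendsto_diag_cos_div_sq_secondMoment_JsB12CombShSym_of_hW` + `secondMoment_TbalOf_JsB12CombShSym_nonneg_of_hW_eventually_diag_cos_nonneg`.

Provenance: cell pub-balaban-gaps, seat g1-p1 GEN 19 (prover-pub-balaban-gaps-g1-p1-g19-0), 2026-08-25∕26 (INTENT-73); imports this seat's row 87 `Gaps/D1CoDressedLongitudinalForm` (p402229 ✓;
through it row 86, an2's `PolarizationSign` ∕ `RowD1SymmetriesDischarged`, GEN 14's dictionaries) — all BUILT; independent of row 94's olean; no existing file touched.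
-/

noncomputable section

open Complex Finset Filter Topology
open scoped ComplexConjugate BigOperators Real

namespace Summit.QuantumFields.BalabanUV.Gaps.D1SymbolSmallMomentumGerm

open Literature.MathematicalPhysics.QuantumFieldTheory.Balaban1983to89
open Literature.MathematicalPhysics.QuantumFieldTheory.Balaban1983to89.Beta.PolarizationSign (WardTransversal IndexSymmetric MomentSummable ConvPSD cosWeight cosWeight_zero
  sq_mul_cosWeight abs_cosWeight_le continuous_cosWeight tsum_eq_zero_of_ward bochner_diag_cos)
open Summit.QuantumFields.BalabanUV.Gaps.D1WardLongitudinalForm (secondMoment_eq_neg_half_of_ward_indexSymmetric)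

variable {d : ℕ}

/-! ## §1 The small-momentum germ of an axis plane-wave sum with vanishing zeroth moment: `Σ_z Q(z) cos(p z_α) = −½ (Σ_z Q(z) z_α²) p² + o(p²)` -/

/-- [folklore] **TANNERY AT ZERO MOMENTUM**: if `Q` is absolutely summable with a second moment along the axis `α` and `Σ_z Q(z) = 0`, then
`(Σ_z Q(z) cos(p z_α)) ∕ p² → −½ Σ_z Q(z) z_α²` as `p → 0`, `p ≠ 0` (`(1 − cos(px))∕p² = (x²∕2)·sinc²(px∕2) → x²∕2` dominatedly; the β sub-cell's `cosWeight` lemmas). -/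
theorem tendsto_tsum_cos_div_sq (Q : (Fin d → ℤ) → ℝ) (α : Fin d) (hQ : Summable fun z => |Q z|) (h2 : Summable fun z => |Q z| * (z α : ℝ) ^ 2)
    (h0 : ∑' z, Q z = 0) :
    Tendsto (fun p : ℝ => (∑' z, Q z * Real.cos (p * z α)) / p ^ 2) (𝓝[≠] 0) (𝓝 (-(1 / 2) * ∑' z, Q z * (z α : ℝ) ^ 2)) := by
  have hQ' : Summable Q := Summable.of_norm_bounded hQ (fun z => le_rfl)
  have hcos : ∀ p : ℝ, Summable fun z => Q z * Real.cos (p * z α) := fun p =>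
    Summable.of_norm_bounded hQ fun z => by
      rw [Real.norm_eq_abs, abs_mul]
      exact mul_le_of_le_one_right (abs_nonneg _) (Real.abs_cos_le_one _)
  -- off zero, the quotient is minus the `cosWeight` sum
  have heq : ∀ p : ℝ, p ≠ 0 → (∑' z, Q z * Real.cos (p * z α)) / p ^ 2 = -∑' z, Q z * cosWeight p (z α) := by
    intro p hp
    have hp2 : (p ^ 2 : ℝ) ≠ 0 := pow_ne_zero 2 hp
    rw [div_eq_iff hp2, neg_mul, ← tsum_mul_right]
    have e : ∑' z, Q z * cosWeight p (z α) * p ^ 2 = ∑' z, (Q z - Q z * Real.cos (p * z α)) := tsum_congr fun z => by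
      rw [mul_assoc, mul_comm (cosWeight p _), sq_mul_cosWeight]; ring
    rw [e, Summable.tsum_sub hQ' (hcos p), h0, zero_sub, neg_neg]
  -- the dominated limit of the `cosWeight` sum
  have hlim : Tendsto (fun p : ℝ => ∑' z, Q z * cosWeight p (z α)) (𝓝[≠] 0) (𝓝 (∑' z, Q z * ((z α : ℝ) ^ 2 / 2))) := by
    refine tendsto_tsum_of_dominated_convergence (bound := fun z => |Q z| * (z α : ℝ) ^ 2 / 2) ?_ (fun z => ?_) ?_
    · simpa [mul_div_assoc] using h2.div_const 2
    · have hc : Continuous fun p : ℝ => Q z * cosWeight p (z α) := continuous_const.mul (continuous_cosWeight _)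
      have ht := hc.tendsto 0
      rw [cosWeight_zero] at ht
      exact ht.mono_left nhdsWithin_le_nhds
    · refine Eventually.of_forall fun p z => ?_
      rw [Real.norm_eq_abs, abs_mul]
      calc |Q z| * |cosWeight p (z α)| ≤ |Q z| * ((z α : ℝ) ^ 2 / 2) := mul_le_mul_of_nonneg_left (abs_cosWeight_le _ _) (abs_nonneg _)
        _ = |Q z| * (z α : ℝ) ^ 2 / 2 := by ring
  have hval : -(∑' z, Q z * ((z α : ℝ) ^ 2 / 2)) = -(1 / 2) * ∑' z, Q z * (z α : ℝ) ^ 2 := by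
    rw [← tsum_mul_left, ← tsum_neg]; exact tsum_congr fun z => by ring
  rw [← hval]
  exact hlim.neg.congr' (eventually_nhdsWithin_of_forall fun p hp => (heq p hp).symm)

/-! ## §2 For a kernel with (5.9) + (5.8) + summable third moments, THE CURVATURE AT ZERO MOMENTUM OF THE DIAGONAL SYMBOL ENTRY `P̂_{ββ}` ALONG THE AXIS `α` IS THE (1.22) COEFFICIENT `β_{αβ}` -/

/-- [folklore] **`(Σ_z P_{ββ}(z) cos(p z_α)) ∕ p² → β_{αβ} = Σ_x P_{αβ}(x) x_α x_β`** (`p → 0`, `p ≠ 0`; `α ≠ β`) under summable third moments, the Ward identity (5.9) and the index symmetry (5.8)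
— the zeroth moment vanishes (`PolarizationSign.tsum_eq_zero_of_ward`) and `−½ Σ_z P_{ββ}(z) z_α² = β_{αβ}` is row 86's hR-free form of (1.22).  This is the diagonal-entry, axis-direction
instance of the printed small-momentum shape (5.16) p. 293 *"Π_{μν}(p) = β(δ_{μν}Δ(p) − ∂̄_μ(p)∂_ν(p)) + …"* (for `μ = ν = β`, `p ∥ e_α`: `Δ(p) ≈ p²`, `∂_β(p) = 0`), obtained here WITHOUT (5.16) and without
the rotation symmetry (1.21) — so with the channel's own coefficient `β_{αβ}`. -/
theorem tendsto_diag_cos_div_sq_secondMoment {P : B12Beta.Kernel d} (hP : MomentSummable P 3) (hT : WardTransversal P) (hS : IndexSymmetric P) {α β : Fin d} (hαβ : α ≠ β) :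
    Tendsto (fun p : ℝ => (∑' z, P β β z * Real.cos (p * z α)) / p ^ 2) (𝓝[≠] 0) (𝓝 (B12Beta.secondMoment P α β)) := by
  rw [secondMoment_eq_neg_half_of_ward_indexSymmetric hP hT hS hαβ]
  exact tendsto_tsum_cos_div_sq (P β β) α (hP.summable_abs β β) (hP.summable_abs_mul_sq β β α) (tsum_eq_zero_of_ward hP hT β β)

/-- [folklore] **THE SIGN OF `β_{αβ}` FROM POSITIVITY OF ONE DIAGONAL SYMBOL ENTRY NEAR ZERO MOMENTUM** — a hypothesis STRICTLY WEAKER than the β sub-cell's Lemma 5.2 input `ConvPSD P`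
(which gives `0 ≤ Σ_z P_{ββ}(z) cos(p z_α)` for ALL `p`, `bochner_diag_cos`): if `0 ≤ Σ_z P_{ββ}(z) cos(p z_α)` for all sufficiently small `p ≠ 0`, then `0 ≤ β_{αβ}`. -/
theorem secondMoment_nonneg_of_eventually_diag_cos_nonneg {P : B12Beta.Kernel d} (hP : MomentSummable P 3) (hT : WardTransversal P) (hS : IndexSymmetric P) {α β : Fin d}
    (hαβ : α ≠ β) (h : ∀ᶠ p in 𝓝[≠] (0 : ℝ), 0 ≤ ∑' z, P β β z * Real.cos (p * z α)) : 0 ≤ B12Beta.secondMoment P α β :=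
  ge_of_tendsto (tendsto_diag_cos_div_sq_secondMoment hP hT hS hαβ) (h.mono fun p hp => div_nonneg hp (sq_nonneg p))

/-- [folklore] **… AND ITS NECESSITY, LOCATED AT SMALL MOMENTA**: if `β_{αβ} < 0` then the diagonal symbol entry `Σ_z P_{ββ}(z) cos(p z_α)` is NEGATIVE for all sufficiently small `p ≠ 0` — so
`ConvPSD P` FAILS (Lemma 5.2's contrapositive), and it fails already against the axis plane waves of small momentum: a by-value PSD certificate cannot avoid resolving the `p → 0` germ,
whose sign IS the sign of `β`. -/
theorem eventually_diag_cos_neg_of_secondMoment_neg {P : B12Beta.Kernel d} (hP : MomentSummable P 3) (hT : WardTransversal P) (hS : IndexSymmetric P) {α β : Fin d} (hαβ : α ≠ β)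
    (hneg : B12Beta.secondMoment P α β < 0) : ∀ᶠ p in 𝓝[≠] (0 : ℝ), ∑' z, P β β z * Real.cos (p * z α) < 0 := by
  have h := (tendsto_diag_cos_div_sq_secondMoment hP hT hS hαβ).eventually (eventually_lt_nhds hneg)
  filter_upwards [h, self_mem_nhdsWithin] with p hp hp0
  have hp2 : 0 < p ^ 2 := by have : p ≠ 0 := hp0; positivity
  exact (div_neg_iff.mp hp).elim (fun h' => absurd h'.2 (not_lt.mpr hp2.le)) fun h' => h'.1

/-- [folklore] … conversely `0 < β_{αβ}` makes the entry POSITIVE for all small `p ≠ 0`. -/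
theorem eventually_diag_cos_pos_of_secondMoment_pos {P : B12Beta.Kernel d} (hP : MomentSummable P 3) (hT : WardTransversal P) (hS : IndexSymmetric P) {α β : Fin d} (hαβ : α ≠ β)
    (hpos : 0 < B12Beta.secondMoment P α β) : ∀ᶠ p in 𝓝[≠] (0 : ℝ), 0 < ∑' z, P β β z * Real.cos (p * z α) := by
  have h := (tendsto_diag_cos_div_sq_secondMoment hP hT hS hαβ).eventually (eventually_gt_nhds hpos)
  filter_upwards [h, self_mem_nhdsWithin] with p hp hp0
  have hp2 : 0 < p ^ 2 := by have : p ≠ 0 := hp0; positivity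
  exact (div_pos_iff.mp hp).elim (fun h' => h'.1) fun h' => absurd h'.2 (not_lt.mpr hp2.le)

/-- [folklore] `ConvPSD P` with `β_{αβ} < 0` is contradictory (Lemma 5.2's contrapositive, through the located necessity). -/
theorem not_convPSD_of_secondMoment_neg {P : B12Beta.Kernel d} (hP : MomentSummable P 3) (hT : WardTransversal P) (hS : IndexSymmetric P) {α β : Fin d} (hαβ : α ≠ β)
    (hneg : B12Beta.secondMoment P α β < 0) : ¬ ConvPSD P := fun hPSD => by
  obtain ⟨p, hp⟩ := (eventually_diag_cos_neg_of_secondMoment_neg hP hT hS hαβ hneg).exists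
  exact absurd (bochner_diag_cos hPSD β α (hP.summable_abs β β) p) (not_le.mpr hp)

/-! ## §3 Dictionary with row 94's real-coordinate symbol: along `k = s·e_α` the real part of the entry `P̂_{μν}` is the axis plane-wave sum at `p = 2πs` -/

/-- [folklore] The real part of a real-coordinate symbol entry is a cosine sum: `Re Σ_z P_{μν}(z) e^{−2πi k·z} = Σ_z P_{μν}(z) cos(2π k·z)`. -/
theorem re_symbolEntry_eq_tsum_cos {P : B12Beta.Kernel d} (hS : ∀ μ ν, Summable fun z => |P μ ν z|) (μ ν : Fin d) (k : Fin d → ℝ) :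
    (∑' z, (P μ ν z : ℂ) * cexp (-(2 * π * I) * ∑ i, (k i : ℂ) * (z i : ℂ))).re = ∑' z, P μ ν z * Real.cos (2 * π * ∑ i, k i * z i) := by
  have hsum : Summable fun z => (P μ ν z : ℂ) * cexp (-(2 * π * I) * ∑ i, (k i : ℂ) * (z i : ℂ)) :=
    Summable.of_norm_bounded (hS μ ν) fun z => by
      rw [norm_mul, Complex.norm_real, Real.norm_eq_abs, Complex.norm_exp]
      have : (-(2 * π * I) * ∑ i, (k i : ℂ) * (z i : ℂ)).re = 0 := by
        rw [show -(2 * π * I) * ∑ i, (k i : ℂ) * (z i : ℂ) = ((-(2 * π * ∑ i, k i * z i) : ℝ) : ℂ) * I by push_cast; ring]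
        simp
      rw [this, Real.exp_zero, mul_one]
  rw [Complex.re_tsum hsum]
  refine tsum_congr fun z => ?_
  rw [show -(2 * π * I) * ∑ i, (k i : ℂ) * (z i : ℂ) = ((-(2 * π * ∑ i, k i * z i) : ℝ) : ℂ) * I by push_cast; ring, Complex.re_ofReal_mul,
    Complex.exp_ofReal_mul_I_re, Real.cos_neg]

/-- [folklore] Along the axis point `k = s·e_α`: `Re P̂_{μν}(s·e_α) = Σ_z P_{μν}(z) cos((2πs) z_α)`. -/
theorem re_symbolEntry_axis {P : B12Beta.Kernel d} (hS : ∀ μ ν, Summable fun z => |P μ ν z|) (μ ν α : Fin d) (s : ℝ) :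
    (∑' z, (P μ ν z : ℂ) * cexp (-(2 * π * I) * ∑ i, ((if i = α then s else 0 : ℝ) : ℂ) * (z i : ℂ))).re = ∑' z, P μ ν z * Real.cos (2 * π * s * z α) := by
  rw [re_symbolEntry_eq_tsum_cos hS]
  refine tsum_congr fun z => ?_
  rw [Finset.sum_eq_single α (fun i _ hi => by simp [hi]) (fun h => absurd (Finset.mem_univ α) h)]
  simp only [if_true]
  ring_nf


/-! ## §4 At the row-(D1) literals (`d = 4`): the small-momentum curvature of ONE diagonal entry of the level-`j` table IS `β⁰_j(μ,ν)`; its eventual sign decides the sign of `β⁰_j` -/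

section Literals

open Literature.MathematicalPhysics.QuantumFieldTheory.Balaban1983to89.Beta
open OneStepResolventKernel (JetData)
open OneStepKernelFamily (TbalOf flipK flipK_apply secondMoment_flipK)
open Summit.QuantumFields.BalabanUV.Beta.MixedJetTablesPlug (JsBalAn1)
open Summit.QuantumFields.BalabanUV.Beta.CombChartJointEnd (JsB12CombShSym)
open Summit.QuantumFields.BalabanUV.Beta.SymmetrisedStepJets (SymTables)
open Summit.QuantumFields.BalabanUV.Beta.RowD1JointEnd (JsRowD1Pin)
open Summit.QuantumFields.BalabanUV.Beta.RowD1SymmetriesDischarged (symmetries_JsRowD1Pin)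
open Summit.QuantumFields.BalabanUV.Gaps.D1IndexSymmetryDictionary (momentSummable_flipK_TbalOf)
open Summit.QuantumFields.BalabanUV.Gaps.D1PinnedIndexSymmetry (indexSymmetric_flipK_TbalOf_JsBalAn1)
open Summit.QuantumFields.BalabanUV.Gaps.D1RecordIndexSymmetry (indexSymmetric_flipK_TbalOf_JsB12CombShSym)
open Summit.QuantumFields.BalabanUV.Gaps.D1CoDressedLongitudinalForm (indexSymmetric_flipK_TbalOf_JsRowD1Pin)

/-- [folklore] The axis plane-wave sum of a diagonal entry is blind to the flip `z ↦ −z` (re-indexing by `Equiv.neg`; `cos` is even). -/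
theorem tsum_diag_cos_flipK (T : B12Beta.Kernel d) (β α : Fin d) (p : ℝ) : ∑' z, flipK T β β z * Real.cos (p * z α) = ∑' z, T β β z * Real.cos (p * z α) := by
  rw [← (Equiv.neg (Fin d → ℤ)).tsum_eq (fun z => T β β z * Real.cos (p * z α))]
  refine tsum_congr fun z => ?_
  simp only [flipK_apply, Equiv.neg_apply, Pi.neg_apply, Int.cast_neg, mul_neg, Real.cos_neg]

variable {Lc : ℕ} [NeZero Lc]

/-- [folklore] **AN2's CHART-(II) LITERAL `JsRowD1Pin hLc N` (`Odd Lc`, `2 ≤ N`), HYPOTHESIS-FREE: the small-momentum curvature of the diagonal entry `Σ_z T_j(ν,ν,z) cos(p z_μ)` IS `β⁰_j(μ,ν)`**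
(`μ ≠ ν`; `T_j := TbalOf Lc (JsRowD1Pin hLc N) j`): `(Σ_z T_j(ν,ν,z) cos(p z_μ)) ∕ p² → B12Beta.secondMoment T_j μ ν` as `p → 0`, `p ≠ 0`. -/
theorem tendsto_diag_cos_div_sq_secondMoment_JsRowD1Pin (hLc : Odd Lc) {N : ℕ} (hN : 2 ≤ N) (j : ℕ) {μ ν : Fin 4} (hμν : μ ≠ ν) :
    Tendsto (fun p : ℝ => (∑' z, TbalOf Lc (JsRowD1Pin hLc N) j ν ν z * Real.cos (p * z μ)) / p ^ 2) (𝓝[≠] 0)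
      (𝓝 (B12Beta.secondMoment (TbalOf Lc (JsRowD1Pin hLc N) j) μ ν)) := by
  have h := tendsto_diag_cos_div_sq_secondMoment (momentSummable_flipK_TbalOf _ j 3) ((symmetries_JsRowD1Pin hLc hN).1 j) (indexSymmetric_flipK_TbalOf_JsRowD1Pin hLc N j) hμν
  simpa only [tsum_diag_cos_flipK, secondMoment_flipK] using h

/-- [folklore] **… HENCE AT `JsRowD1Pin` THE SIGN OF `β⁰_j(μ,ν)` FOLLOWS FROM THE EVENTUAL SIGN OF ONE DIAGONAL ENTRY NEAR ZERO MOMENTUM** (no `ConvPSD`, no other hypothesis):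
`(∀ᶠ p → 0, p ≠ 0: 0 ≤ Σ_z T_j(ν,ν,z) cos(p z_μ)) ⟹ 0 ≤ β⁰_j(μ,ν)`. -/
theorem secondMoment_TbalOf_JsRowD1Pin_nonneg_of_eventually_diag_cos_nonneg (hLc : Odd Lc) {N : ℕ} (hN : 2 ≤ N) (j : ℕ) {μ ν : Fin 4} (hμν : μ ≠ ν)
    (h : ∀ᶠ p in 𝓝[≠] (0 : ℝ), 0 ≤ ∑' z, TbalOf Lc (JsRowD1Pin hLc N) j ν ν z * Real.cos (p * z μ)) :
    0 ≤ B12Beta.secondMoment (TbalOf Lc (JsRowD1Pin hLc N) j) μ ν :=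
  ge_of_tendsto (tendsto_diag_cos_div_sq_secondMoment_JsRowD1Pin hLc hN j hμν) (h.mono fun p hp => div_nonneg hp (sq_nonneg p))

variable {r : Fin (3 + 1) → ℕ}

/-- [folklore] **THE β-LEAD's PINNED FAMILY `JsBalAn1 …` UNDER `hW_j`** (any `1 ≤ Lc`, root, colours, `cE₂`, `cB`, `T`; (5.8) a theorem, GEN 14): the small-momentum curvature of
`Σ_z T_j(ν,ν,z) cos(p z_μ)` IS `β⁰_j(μ,ν)` (`μ ≠ ν`). -/
theorem tendsto_diag_cos_div_sq_secondMoment_JsBalAn1_of_hW (hLc : 1 ≤ Lc) (hr : r ∈ AffineAveraging.box (3 + 1) Lc) (cE cVH cΛ cE₂ cB : ℝ) (T : Fin 4 → Fin 4 → Fin 4 → Fin 4 → ℝ)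
    (j : ℕ) (hW : WardTransversal (flipK (TbalOf Lc (JsBalAn1 hLc hr cE cVH cΛ cE₂ cB T) j))) {μ ν : Fin 4} (hμν : μ ≠ ν) :
    Tendsto (fun p : ℝ => (∑' z, TbalOf Lc (JsBalAn1 hLc hr cE cVH cΛ cE₂ cB T) j ν ν z * Real.cos (p * z μ)) / p ^ 2) (𝓝[≠] 0)
      (𝓝 (B12Beta.secondMoment (TbalOf Lc (JsBalAn1 hLc hr cE cVH cΛ cE₂ cB T) j) μ ν)) := by
  have h := tendsto_diag_cos_div_sq_secondMoment (momentSummable_flipK_TbalOf _ j 3) hW (indexSymmetric_flipK_TbalOf_JsBalAn1 hLc hr cE cVH cΛ cE₂ cB T j) hμν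
  simpa only [tsum_diag_cos_flipK, secondMoment_flipK] using h

/-- [folklore] **… HENCE, UNDER `hW_j`, `(∀ᶠ p → 0: 0 ≤ Σ_z T_j(ν,ν,z) cos(p z_μ)) ⟹ 0 ≤ β⁰_j(μ,ν)`** at the pinned family — the PSD binder of rows 86 ∕ 92 ∕ 94 replaced by the eventual
sign of ONE diagonal entry near zero momentum. -/
theorem secondMoment_TbalOf_JsBalAn1_nonneg_of_hW_eventually_diag_cos_nonneg (hLc : 1 ≤ Lc) (hr : r ∈ AffineAveraging.box (3 + 1) Lc) (cE cVH cΛ cE₂ cB : ℝ)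
    (T : Fin 4 → Fin 4 → Fin 4 → Fin 4 → ℝ) (j : ℕ) (hW : WardTransversal (flipK (TbalOf Lc (JsBalAn1 hLc hr cE cVH cΛ cE₂ cB T) j))) {μ ν : Fin 4} (hμν : μ ≠ ν)
    (h : ∀ᶠ p in 𝓝[≠] (0 : ℝ), 0 ≤ ∑' z, TbalOf Lc (JsBalAn1 hLc hr cE cVH cΛ cE₂ cB T) j ν ν z * Real.cos (p * z μ)) :
    0 ≤ B12Beta.secondMoment (TbalOf Lc (JsBalAn1 hLc hr cE cVH cΛ cE₂ cB T) j) μ ν :=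
  ge_of_tendsto (tendsto_diag_cos_div_sq_secondMoment_JsBalAn1_of_hW hLc hr cE cVH cΛ cE₂ cB T j hW hμν) (h.mono fun p hp => div_nonneg hp (sq_nonneg p))

/-- [folklore] **THE b2b WALL's (III′) LITERAL `JsB12CombShSym hLc N tabs cΛ cB` UNDER `hW_j`** (every table record; `Odd Lc`; (5.8) a theorem, GEN 14): the small-momentum curvature of
`Σ_z T_j(ν,ν,z) cos(p z_μ)` IS `β⁰_j(μ,ν)` (`μ ≠ ν`). -/
theorem tendsto_diag_cos_div_sq_secondMoment_JsB12CombShSym_of_hW (hLc : Odd Lc) (N : ℕ) (tabs : SymTables 3 Lc) (cΛ cB : ℝ) (j : ℕ)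
    (hW : WardTransversal (flipK (TbalOf Lc (JsB12CombShSym hLc N tabs cΛ cB) j))) {μ ν : Fin 4} (hμν : μ ≠ ν) :
    Tendsto (fun p : ℝ => (∑' z, TbalOf Lc (JsB12CombShSym hLc N tabs cΛ cB) j ν ν z * Real.cos (p * z μ)) / p ^ 2) (𝓝[≠] 0)
      (𝓝 (B12Beta.secondMoment (TbalOf Lc (JsB12CombShSym hLc N tabs cΛ cB) j) μ ν)) := by
  have h := tendsto_diag_cos_div_sq_secondMoment (momentSummable_flipK_TbalOf _ j 3) hW (indexSymmetric_flipK_TbalOf_JsB12CombShSym hLc N tabs cΛ cB j) hμν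
  simpa only [tsum_diag_cos_flipK, secondMoment_flipK] using h

/-- [folklore] **… HENCE, UNDER `hW_j`, `(∀ᶠ p → 0: 0 ≤ Σ_z T_j(ν,ν,z) cos(p z_μ)) ⟹ 0 ≤ β⁰_j(μ,ν)`** at the (III′) literal. -/
theorem secondMoment_TbalOf_JsB12CombShSym_nonneg_of_hW_eventually_diag_cos_nonneg (hLc : Odd Lc) (N : ℕ) (tabs : SymTables 3 Lc) (cΛ cB : ℝ) (j : ℕ)
    (hW : WardTransversal (flipK (TbalOf Lc (JsB12CombShSym hLc N tabs cΛ cB) j))) {μ ν : Fin 4} (hμν : μ ≠ ν)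
    (h : ∀ᶠ p in 𝓝[≠] (0 : ℝ), 0 ≤ ∑' z, TbalOf Lc (JsB12CombShSym hLc N tabs cΛ cB) j ν ν z * Real.cos (p * z μ)) :
    0 ≤ B12Beta.secondMoment (TbalOf Lc (JsB12CombShSym hLc N tabs cΛ cB) j) μ ν :=
  ge_of_tendsto (tendsto_diag_cos_div_sq_secondMoment_JsB12CombShSym_of_hW hLc N tabs cΛ cB j hW hμν) (h.mono fun p hp => div_nonneg hp (sq_nonneg p))

end Literals

end Summit.QuantumFields.BalabanUV.Gaps.D1SymbolSmallMomentumGerm
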